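import Literature.MathematicalPhysics.QuantumFieldTheory.Balaban1983to89.B4ConstantsWindow
import Literature.MathematicalPhysics.QuantumFieldTheory.Balaban1983to89.B4Eq54RegularRegion

/-!
# `Balaban1983to89.B4Prop23WindowBounds` — T. Bałaban, *Regularity and decay of lattice Green's functions*, Commun.
# Math. Phys. **89** (1983) 571–597 [Balaban1983RegularityDecay] (= B4), «Proposition 2.3 of [1]» p. 574 at a regular
# `A ≠ 0`: (5.6), (5.9) and (1.15)–(1.20) on the two-level carriers with constants UNIFORM OVER THE WINDOW `a_k ∈ [a₋, a₊]`

statement-level skeleton of published theorems with citation tags; proofs where landed; nothing here is a claim about the Yang–Mills mass gap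

PDF held: `paper:balaban1983-cmp89-regularity-decay` (journal page = PDF page + 570); pp. 574, 593–594 [PDF 4, 23–24]
read on the ×2 renders `…/b2b-balaban-ref1/pages/1983-cmp89-regularity-decay/…-p0NN-x2.png`.

CITATION HEADER (lean-in-tree rule).  Cell `lit-balaban` (HOME `run/shared/lean/pub/lit-balaban/`), Phase-2 proof seat
**p17** gen 3 (unit `lit-balaban-p17-g3`), file 8b — row **B4.Prop2.3[I]** (owner r01, referee ref-4), GAPS **G-B4-p17-01**
(«a_k-window uniformity»).  p. 574: *"There exist positive constants δ₀, c₀, γ₀, γ₁ dependent on d and M only and such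
that for e sufficiently small and arbitrary Λ ⊂ Ω^{(k)} … we have (1.15) … (1.16) … (1.18) … (1.20)"* — constants
independent of `k`, i.e. of `a_k` («a_k is a constant proportional to a», p. 573).  With the window constants of file 8a
(`B4ConstantsWindow`: `γW = γ₀″(a₋) = gamLow d L a₋ a′ m²₊`, `cW`, `dW`) this file weakens the conditions (5.6), (5.9) of
file 7 (`B4Eq54RegularRegion.hyp56_regular`, `hyp56_ambient_regular`, `hyp59_regular`) to `(γW, cW, dW)` for every
`a_k ∈ [a₋,a₊]` (`hyp56_window`, `hyp56_ambient_window`, `hyp59_window`) and applies r01's kernel-proved Sect. 5 Theorem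
(`B4Prop23Sect5Route.prop23_of_sect5`) ONCE with them: **`prop23_116_118_window`** ((1.16), (1.17)–(1.18)) and
**`prop23_120_window`** ((1.19)–(1.20)) with `c₀ = c0W = cSt K γW cW dW`, `δ₀ = d0W = dSt K γW cW dW` THE SAME FOR ALL
`a_k ∈ [a₋,a₊]`; **`form115_window`** ((1.15) with `γ₀ = γW`, `γ₁ = a₊ + a′L^{−2}`).  Two real constants `c0W`, `d0W` as
`def`s; no `Prop`-valued definition.  The family-level leaf is file 8c `B4Prop23RegularWindow`.

HONEST SCOPE.  As files 2–8a: finite nested block unions, (1.7) on `Ω₀`, `|x−x′| = |·|_∞`, complements read inside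
`Ω^{(k)}`, `Ω₀^{(k)}`, rate of the `δG` input halved (D-b04g14-3); window `0 < a₋ ≤ a₊`, `0 ≤ m²₊`; constants depend on
`(d, N, L, a₋, a₊, a′, c, β, ℓ, m²₊)`.  Unit `lit-balaban-p17-g3`.
-/

namespace Literature.MathematicalPhysics.QuantumFieldTheory.Balaban1983to89.B4Prop23WindowBounds

open Finset Matrix
open Literature.MathematicalPhysics.QuantumFieldTheory.Balaban1983to89
open Literature.MathematicalPhysics.QuantumFieldTheory.Balaban1983to89.B4GaugeCovariance (OrthFlow)
open Literature.MathematicalPhysics.QuantumFieldTheory.Balaban1983to89.B4Lower18Regular (e1)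
open Literature.MathematicalPhysics.QuantumFieldTheory.Balaban1983to89.B4Lower18 (fineDom)
open Literature.MathematicalPhysics.QuantumFieldTheory.Balaban1983to89.B4Sect5Torus (Hyp56 Hyp59 cSt dSt cSt_pos dSt_pos)
open Literature.MathematicalPhysics.QuantumFieldTheory.Balaban1983to89.B4Sect5Proof (weaken)
open Literature.MathematicalPhysics.QuantumFieldTheory.Balaban1983to89.B4GaussRep36 (pOp cLam)
open Literature.MathematicalPhysics.QuantumFieldTheory.Balaban1983to89.B4Prop23Sect5Route (prop23_of_sect5)
open Literature.MathematicalPhysics.QuantumFieldTheory.Balaban1983to89.B4Cor23Rep36Bridge (hamR QkR)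
open Literature.MathematicalPhysics.QuantumFieldTheory.Balaban1983to89.B4NextAvg52 (nextAvg)
open Literature.MathematicalPhysics.QuantumFieldTheory.Balaban1983to89.B4Ineq53RegularRegion (gam0 gamLow gamLow_pos
  form115_lower_regular form115_upper_regular)
open Literature.MathematicalPhysics.QuantumFieldTheory.Balaban1983to89.B4Prop23RegularRegion (rhoY profK rhoY_isPseudoDist
  rhoY_sumBound profK_nonneg)
open Literature.MathematicalPhysics.QuantumFieldTheory.Balaban1983to89.B4Ineq120RegularAmbient (fine_sub ham0)
open Literature.MathematicalPhysics.QuantumFieldTheory.Balaban1983to89.B4Ineq120RegularRegion (omegaY omegaY_nonneg omegaY_lip)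
open Literature.MathematicalPhysics.QuantumFieldTheory.Balaban1983to89.B4Eq54RegularRegion (hyp56_regular
  hyp56_ambient_regular hyp59_regular)
open Literature.MathematicalPhysics.QuantumFieldTheory.Balaban1983to89.B4ConstantsWindow (gamLow_mono cW dW cW_pos dW_pos
  dW_le consts_le)

noncomputable section

variable {d : ℕ} {ι : Type} [Fintype ι] [DecidableEq ι]

/-! ## §1. The window constants `c₀`, `δ₀` of (1.16)–(1.20) -/

/-- `c0W` — THE constant `c₀` of (1.16), (1.18), (1.20) at a regular `A ≠ 0`, uniform on `a_k ∈ [a₋,a₊]`: the Sect. 5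
Theorem's `cSt` at `(γ₀″(a₋), cW, dW)`. [cite: Balaban1983RegularityDecay, Prop. 2.3 of [1] p.574 «c₀ … dependent on d and M only», Sect. 5 Theorem (5.7)–(5.10) p.594] -/
def c0W (ι : Type) [Fintype ι] (d L : ℕ) (aminus aplus a' m2max : ℝ) : ℝ :=
  cSt (profK ι d) (gamLow d L aminus a' m2max) (cW d L aminus aplus a') (dW d aminus aplus)

/-- `d0W` — THE rate `δ₀` of (1.16), (1.18), (1.20) at a regular `A ≠ 0`, uniform on `a_k ∈ [a₋,a₊]`: the Sect. 5
Theorem's `dSt` at `(γ₀″(a₋), cW, dW)`. [cite: Balaban1983RegularityDecay, Prop. 2.3 of [1] p.574 «δ₀ … dependent on d and M only», Sect. 5 Theorem (5.7)–(5.10) p.594] -/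
def d0W (ι : Type) [Fintype ι] (d L : ℕ) (aminus aplus a' m2max : ℝ) : ℝ :=
  dSt (profK ι d) (gamLow d L aminus a' m2max) (cW d L aminus aplus a') (dW d aminus aplus)

omit [DecidableEq ι] in
/-- `c0W > 0`. [cite: Balaban1983RegularityDecay, Prop. 2.3 of [1] p.574 «positive constants»] -/
theorem c0W_pos (d : ℕ) {L : ℕ} (hL : 1 ≤ L) (aminus aplus : ℝ) {a' : ℝ} (ha' : 0 < a') (m2max : ℝ) :
    0 < c0W ι d L aminus aplus a' m2max :=
  cSt_pos _ _ _ (gamLow_pos d hL aminus ha' m2max)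

omit [DecidableEq ι] in
/-- `d0W > 0`. [cite: Balaban1983RegularityDecay, Prop. 2.3 of [1] p.574 «positive constants»] -/
theorem d0W_pos (d : ℕ) {L : ℕ} (hL : 1 ≤ L) {aminus aplus : ℝ} (ham : 0 < aminus) (hle : aminus ≤ aplus) {a' : ℝ}
    (ha' : 0 < a') (m2max : ℝ) : 0 < d0W ι d L aminus aplus a' m2max :=
  dSt_pos (profK_nonneg (ι := ι)) (gamLow_pos d hL aminus ha' m2max) (cW_pos d hL ham hle ha').le (dW_pos d ham hle)

/-! ## §2. (5.6), (5.9) with the window constants -/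

section Window

omit [DecidableEq ι] in
/-- weakening the constants of (5.6). [cite: Balaban1983RegularityDecay, (5.6) p.594] -/
private theorem hyp56_weaken {Y : Type} [Fintype Y] [DecidableEq Y] {ρ : Y → Y → ℝ} {A : Matrix Y Y ℝ}
    {γ c δ γ' c' δ' : ℝ} (h : Hyp56 ρ A γ c δ) (hγ : γ' ≤ γ) (hc0 : 0 ≤ c) (hc : c ≤ c') (hδ : δ' ≤ δ)
    (hρ : ∀ p q, 0 ≤ ρ p q) : Hyp56 ρ A γ' c' δ' := by
  refine ⟨h.1, fun v => le_trans ?_ (h.2.1 v), fun p q => (h.2.2 p q).trans (weaken hc0 hc hδ (hρ p q))⟩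
  exact mul_le_mul_of_nonneg_right hγ (Finset.sum_nonneg fun p _ => sq_nonneg (v p))

omit [DecidableEq ι] in
/-- weakening the constants of (5.9). [cite: Balaban1983RegularityDecay, (5.9) p.594] -/
private theorem hyp59_weaken {Y : Type} [Fintype Y] [DecidableEq Y] {ρ : Y → Y → ℝ} {ω : Y → ℝ} {B : Matrix Y Y ℝ}
    {c δ c' δ' : ℝ} (h : Hyp59 ρ ω B c δ) (hc0 : 0 ≤ c) (hc : c ≤ c') (hδ : δ' ≤ δ)
    (hρ : ∀ p q, 0 ≤ ρ p q) (hω : ∀ p, 0 ≤ ω p) : Hyp59 ρ ω B c' δ' := fun p q =>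
  (h p q).trans (weaken hc0 hc hδ (by have := hρ p q; have := hω p; have := hω q; positivity))

variable {n L : ℕ} (hn : 1 ≤ n) (hL : 1 ≤ L) {Zc Z₀c : Finset (Fin (d + 1) → ℤ)} (hsub : Zc ⊆ Z₀c)
  (F : OrthFlow ι) {ℓ : ℝ} (hℓ : 0 ≤ ℓ)
  (hLip : ∀ t (v : ι → ℝ), ((F.U t - 1) *ᵥ v) ⬝ᵥ ((F.U t - 1) *ᵥ v) ≤ (ℓ * t) ^ 2 * (v ⬝ᵥ v))
  {e : ℝ} (he : 0 < e) {aminus aplus a : ℝ} (ham : 0 < aminus) (h1 : aminus ≤ a) (h2 : a ≤ aplus)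
  {a' : ℝ} (ha' : 0 < a') {m2 m2max : ℝ} (hm : 0 ≤ m2) (hmm : m2 ≤ m2max) (hm0 : 0 ≤ m2max)
  {Ac : (Fin (d + 1) → ℤ) → Fin (d + 1) → ℝ} {c β : ℝ} (hc : 0 ≤ c)
  (h17 : ∀ x ∈ fineDom n (fineDom L Z₀c), ∀ μ ν : Fin (d + 1), |Ac (x + e1 μ) ν - Ac x ν| ≤ c * e ^ (β - 1) / n)
  (hsmall : ℓ ^ 2 * ((d + 1) * c * e ^ β) ^ 2 * (d + 1) * (1 + a * (d + 1)) ≤ min 2 a / 4)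
  (hsmallU : ℓ ^ 2 * ((d + 1) * ((L : ℝ) ^ 2 * c) * e ^ β) ^ 2 * (d + 1)
      * (1 + (a' / gam0 d a m2max) * (d + 1)) ≤ min 2 (a' / gam0 d a m2max) / 4)
  (hX : gam0 d a m2 * (6 * (d + 1) * (a / (min 2 a / 4 + m2)) ^ 2 * (ℓ * ((3 * d + 4) * c * e ^ β)) ^ 2)
      ≤ gamLow d L a a' m2max)

include hsub hℓ hLip he ham h1 h2 ha' hm hmm hm0 hc h17 hsmall hsmallU hX in
/-- **(5.6) FOR `Δ^{(k)}(Ω,A) + a′L^{−2}P(A)` WITH THE WINDOW CONSTANTS** `(γ₀″(a₋), cW, dW)`, for every `a_k = a ∈ [a₋,a₊]`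
(file 7's `hyp56_regular`, weakened by file 8a). [cite: Balaban1983RegularityDecay, (5.6) p.594, (5.3)–(5.4) p.593, Prop. 2.3 p.574 «constants dependent on d and M only»] -/
theorem hyp56_window :
    Hyp56 (rhoY L Zc) (B4GaussRep36.deltaK (hamR F e m2 (fineDom L Zc) Ac n) a (QkR F e hn (fineDom L Zc) Ac)
        + (a' * ((L : ℝ) ^ 2)⁻¹) • pOp (((L ^ (d + 1) : ℕ) : ℝ)) (nextAvg F (e / n) hL Zc n Ac))
      (gamLow d L aminus a' m2max) (cW d L aminus aplus a') (dW d aminus aplus) := by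
  have ha : 0 < a := ham.trans_le h1
  obtain ⟨⟨h0, hle⟩, -, -⟩ := consts_le d L ham h1 h2 ha'
  have h17' : ∀ x ∈ fineDom n (fineDom L Zc), ∀ μ ν : Fin (d + 1), |Ac (x + e1 μ) ν - Ac x ν| ≤ c * e ^ (β - 1) / n :=
    fun x hx => h17 x (fine_sub hn hL hsub hx)
  refine hyp56_weaken (hyp56_regular F hℓ hLip he hn hL ha ha' hm hmm Zc hc h17' hsmall hsmallU hX)
    (gamLow_mono d L ham h1 hm0) h0 hle ?_ (fun p q => (rhoY_isPseudoDist (ι := ι) Zc).nonneg p q)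
  linarith [dW_le d ham h1 h2, dW_pos d ham (h1.trans h2)]

include hℓ hLip he ham h1 h2 ha' hm hmm hm0 hc h17 hsmall hsmallU hX in
/-- **(5.6) FOR THE OPERATOR OF `Ω₀` SEEN FROM `Ω^{(k)}` WITH THE SAME WINDOW CONSTANTS** (file 7's `hyp56_ambient_regular`,
weakened). [cite: Balaban1983RegularityDecay, (5.6) p.594, (5.3)–(5.4) p.593] -/
theorem hyp56_ambient_window :
    Hyp56 (rhoY L Zc) (B4GaussRep36.deltaK (ham0 F e hn hL a m2 hsub Ac) a (QkR F e hn (fineDom L Zc) Ac)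
        + (a' * ((L : ℝ) ^ 2)⁻¹) • pOp (((L ^ (d + 1) : ℕ) : ℝ)) (nextAvg F (e / n) hL Zc n Ac))
      (gamLow d L aminus a' m2max) (cW d L aminus aplus a') (dW d aminus aplus) := by
  have ha : 0 < a := ham.trans_le h1
  obtain ⟨-, ⟨h0, hle⟩, -⟩ := consts_le d L ham h1 h2 ha'
  exact hyp56_weaken (hyp56_ambient_regular hn hL hsub F hℓ hLip he ha ha' hm hmm hc h17 hsmall hsmallU hX)
    (gamLow_mono d L ham h1 hm0) h0 hle (dW_le d ham h1 h2) (fun p q => (rhoY_isPseudoDist (ι := ι) Zc).nonneg p q)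

include hℓ hLip he ham h1 h2 ha' hm hc h17 hsmall in
/-- **(5.9) WITH THE WINDOW CONSTANTS** for `B = Δ^{(k)}(Ω₀,A)|_{Ω^{(k)}} − Δ^{(k)}(Ω,A)` (file 7's `hyp59_regular`,
weakened). [cite: Balaban1983RegularityDecay, (5.9) p.594, (5.5) p.594] -/
theorem hyp59_window :
    Hyp59 (rhoY L Zc) (omegaY L Zc Z₀c)
      (B4GaussRep36.deltaK (ham0 F e hn hL a m2 hsub Ac) a (QkR F e hn (fineDom L Zc) Ac)
        - B4GaussRep36.deltaK (hamR F e m2 (fineDom L Zc) Ac n) a (QkR F e hn (fineDom L Zc) Ac))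
      (cW d L aminus aplus a') (dW d aminus aplus) := by
  have ha : 0 < a := ham.trans_le h1
  obtain ⟨-, -, ⟨h0, hle⟩⟩ := consts_le d L ham h1 h2 ha'
  exact hyp59_weaken (hyp59_regular hn hL hsub F hℓ hLip he ha hm hc h17 hsmall) h0 hle (dW_le d ham h1 h2)
    (fun p q => (rhoY_isPseudoDist (ι := ι) Zc).nonneg p q) (omegaY_nonneg (Z₀c := Z₀c))

/-! ## §3. (1.15)–(1.20) with the window constants -/

include hsub hℓ hLip he ham h1 h2 ha' hm hmm hm0 hc h17 hsmall hsmallU hX in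
/-- **(1.15) WITH WINDOW-UNIFORM CONSTANTS** `γ₀ = γ₀″(a₋)`, `γ₁ = a₊ + a′L^{−2}` (file 2's `form115_lower_regular`,
`form115_upper_regular` and `gamLow_mono`). [cite: Balaban1983RegularityDecay, Prop. 2.3 of [1] (1.15) p.574, (5.1)–(5.3) p.593] -/
theorem form115_window (ψ : ↥(fineDom L Zc) × ι → ℝ) :
    gamLow d L aminus a' m2max * (ψ ⬝ᵥ ψ)
      ≤ ψ ⬝ᵥ ((B4GaussRep36.deltaK (hamR F e m2 (fineDom L Zc) Ac n) a (QkR F e hn (fineDom L Zc) Ac)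
          + (a' * ((L : ℝ) ^ 2)⁻¹) • pOp (((L ^ (d + 1) : ℕ) : ℝ)) (nextAvg F (e / n) hL Zc n Ac)) *ᵥ ψ) ∧
    ψ ⬝ᵥ ((B4GaussRep36.deltaK (hamR F e m2 (fineDom L Zc) Ac n) a (QkR F e hn (fineDom L Zc) Ac)
          + (a' * ((L : ℝ) ^ 2)⁻¹) • pOp (((L ^ (d + 1) : ℕ) : ℝ)) (nextAvg F (e / n) hL Zc n Ac)) *ᵥ ψ)
      ≤ (aplus + a' * ((L : ℝ) ^ 2)⁻¹) * (ψ ⬝ᵥ ψ) := by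
  have ha : 0 < a := ham.trans_le h1
  have h17' : ∀ x ∈ fineDom n (fineDom L Zc), ∀ μ ν : Fin (d + 1), |Ac (x + e1 μ) ν - Ac x ν| ≤ c * e ^ (β - 1) / n :=
    fun x hx => h17 x (fine_sub hn hL hsub hx)
  have hψ : 0 ≤ ψ ⬝ᵥ ψ := by
    rw [dotProduct]; exact Finset.sum_nonneg fun p _ => mul_self_nonneg (ψ p)
  exact ⟨le_trans (mul_le_mul_of_nonneg_right (gamLow_mono d L ham h1 hm0) hψ)
    (form115_lower_regular F hℓ hLip he hn hL ha ha' hm hmm Zc hc h17' hsmall hsmallU hX ψ),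
    (form115_upper_regular F hℓ hLip he hn hL ha ha' hm Zc hc h17' hsmall ψ).trans
      (mul_le_mul_of_nonneg_right (by linarith) hψ)⟩

include hsub hℓ hLip he ham h1 h2 ha' hm hmm hm0 hc h17 hsmall hsmallU hX in
/-- **(1.16) AND (1.17)–(1.18) AT A REGULAR `A ≠ 0`, EVERY `Λ`, WITH WINDOW-UNIFORM CONSTANTS**: for every
`a_k = a ∈ [a₋,a₊]` (data as in file 3, (1.7) on `Ω₀`), the entries of `C^{(k)}_Λ(Ω,A)` and of
`C^{(k)}_Λ − (Δ^{(k)}+a′L^{−2}P)^{−1}` satisfy (1.16), (1.18) with `c₀ = c0W`, `δ₀ = d0W` INDEPENDENT OF `a_k` — r01's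
kernel-proved Sect. 5 Theorem (`prop23_of_sect5`) applied once with the uniform (5.6) (`hyp56_window`).
[cite: Balaban1983RegularityDecay, Prop. 2.3 of [1] (1.16)–(1.18) p.574 «constants dependent on d and M only», Sect. 5 Theorem p.594] -/
theorem prop23_116_118_window (Λ : Finset (↥(fineDom L Zc) × ι)) :
    (∀ y y' : Λ, |cLam (hamR F e m2 (fineDom L Zc) Ac n) a (QkR F e hn (fineDom L Zc) Ac) a' (((L : ℝ) ^ 2)⁻¹)
        (((L ^ (d + 1) : ℕ) : ℝ)) (nextAvg F (e / n) hL Zc n Ac) Λ y y'|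
        ≤ c0W ι d L aminus aplus a' m2max * Real.exp (-(d0W ι d L aminus aplus a' m2max * rhoY L Zc y.1 y'.1))) ∧
    (∀ β : Λ → ℝ, (∀ y, 0 ≤ β y) → (∀ (y : Λ) (z : ↥(fineDom L Zc) × ι), z ∉ Λ → β y ≤ rhoY L Zc y.1 z) →
      ∀ y y' : Λ, |cLam (hamR F e m2 (fineDom L Zc) Ac n) a (QkR F e hn (fineDom L Zc) Ac) a' (((L : ℝ) ^ 2)⁻¹)
            (((L ^ (d + 1) : ℕ) : ℝ)) (nextAvg F (e / n) hL Zc n Ac) Λ y y'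
          - (B4GaussRep36.deltaK (hamR F e m2 (fineDom L Zc) Ac n) a (QkR F e hn (fineDom L Zc) Ac)
              + (a' * ((L : ℝ) ^ 2)⁻¹) • pOp (((L ^ (d + 1) : ℕ) : ℝ)) (nextAvg F (e / n) hL Zc n Ac))⁻¹ y y'|
        ≤ c0W ι d L aminus aplus a' m2max *
          Real.exp (-(d0W ι d L aminus aplus a' m2max * (rhoY L Zc y.1 y'.1 + β y + β y')))) := by
  have H := prop23_of_sect5 (K := profK ι d) (profK_nonneg (ι := ι)) (gamLow_pos d hL aminus ha' m2max)
    (cW_pos d hL ham (h1.trans h2) ha') (dW_pos d ham (h1.trans h2))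
    (rhoY_isPseudoDist (ι := ι) Zc) (rhoY_sumBound (ι := ι) Zc)
    (hyp56_window hn hL hsub F hℓ hLip he ham h1 h2 ha' hm hmm hm0 hc h17 hsmall hsmallU hX) Λ
  exact ⟨H.1, H.2.1⟩

include hℓ hLip he ham h1 h2 ha' hm hmm hm0 hc h17 hsmall hsmallU hX in
/-- **(1.19)–(1.20) AT A REGULAR `A ≠ 0`, EVERY `Λ`, WITH WINDOW-UNIFORM CONSTANTS** (same `c₀ = c0W`, `δ₀ = d0W` as
`prop23_116_118_window`): r01's `prop23_of_sect5`, third conclusion, with the uniform (5.6) for both operators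
(`hyp56_window`, `hyp56_ambient_window`) and the uniform (5.9) (`hyp59_window`).
[cite: Balaban1983RegularityDecay, Prop. 2.3 of [1] (1.19)–(1.20) p.574 «constants dependent on d and M only», (5.5) p.594, Sect. 5 Theorem (5.10) p.594] -/
theorem prop23_120_window (Λ : Finset (↥(fineDom L Zc) × ι)) (y y' : Λ) :
    |cLam (hamR F e m2 (fineDom L Zc) Ac n) a (QkR F e hn (fineDom L Zc) Ac) a' (((L : ℝ) ^ 2)⁻¹)
          (((L ^ (d + 1) : ℕ) : ℝ)) (nextAvg F (e / n) hL Zc n Ac) Λ y y'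
      - cLam (ham0 F e hn hL a m2 hsub Ac) a (QkR F e hn (fineDom L Zc) Ac) a' (((L : ℝ) ^ 2)⁻¹)
          (((L ^ (d + 1) : ℕ) : ℝ)) (nextAvg F (e / n) hL Zc n Ac) Λ y y'|
      ≤ c0W ι d L aminus aplus a' m2max *
        Real.exp (-(d0W ι d L aminus aplus a' m2max *
          (rhoY L Zc y.1 y'.1 + omegaY L Zc Z₀c y.1 + omegaY L Zc Z₀c y'.1))) :=
  (prop23_of_sect5 (K := profK ι d) (profK_nonneg (ι := ι)) (gamLow_pos d hL aminus ha' m2max)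
    (cW_pos d hL ham (h1.trans h2) ha') (dW_pos d ham (h1.trans h2))
    (rhoY_isPseudoDist (ι := ι) Zc) (rhoY_sumBound (ι := ι) Zc)
    (hyp56_window hn hL hsub F hℓ hLip he ham h1 h2 ha' hm hmm hm0 hc h17 hsmall hsmallU hX) Λ).2.2 _ _
    (hyp56_ambient_window hn hL hsub F hℓ hLip he ham h1 h2 ha' hm hmm hm0 hc h17 hsmall hsmallU hX)
    (omegaY_nonneg (Z₀c := Z₀c)) (omegaY_lip (Z₀c := Z₀c))
    (hyp59_window hn hL hsub F hℓ hLip he ham h1 h2 ha' hm hc h17 hsmall) y y'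

end Window

end

end Literature.MathematicalPhysics.QuantumFieldTheory.Balaban1983to89.B4Prop23WindowBounds
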